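import Literature.Analysis.FluidPDE.BlowupBesovSlices
import Literature.Analysis.FluidPDE.SuitableWeakInBallTools
import Literature.Analysis.FluidPDE.LocalTypeIProofs
import Literature.Analysis.FluidPDE.LocalTypeIScaling
import Literature.Analysis.FluidPDE.CKNScalingExtras
import Literature.Analysis.FunctionSpaces.BesovTranslationVanishing
import Literature.Analysis.FluidPDE.AncientLimitVanishingScaled
import Mathlib.Analysis.Distribution.AEEqOfIntegralContDiff
import HarnessLib

/-!
# Far-field smallness of `C(1; z₀)` for an ancient solution with Besov slices
# (Wang–Zhang 2017, §4 Step 1, spatial decay of the blow-up limit)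

Analysis/FluidPDE proofs-only file (theorems only: no definition, no named fact; nothing accepted
is restated or changed). In W. Wang, Z. Zhang, *Blow-up of critical norms for the 3-D
Navier–Stokes equations*, Sci. China Math. 60 (2017) = arXiv:1510.02589, §4, the blow-up limit
`v` has slices in `Ḃ^{-1+3/p}_{p,q}` ((4.4)) and this is used to show that `v` is small far out
in space ("`|v(x,t)| + |∇v(x,t)| ≤ C/|x|` for `|x| > R`", Step 1, via `v ∈ L^∞(-1,0; L⁴(ℝ³∖B_R))`).
Here the far-field smallness is obtained in the integral form consumed by the tree's
`exists_farField_ae_norm_le_of_cknC_farField_small` (`AncientFarFieldBound.lean`):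
`C(1; (t₀, x₀))[w] → 0` as `|x₀| → ∞`, uniformly for `t₀` in a bounded window
(`farField_cknC_small_of_ae_slice_memHomBesov`), for a pair `(w, π)` that is a suitable weak
solution in every `Q(a)`, has `C, D ≤ K` at all apices `t ≤ 0` and all radii, and whose slices
are, for a.e. `t`, represented by realised `Ḃ^s_{p,q}` distributions (`-2 < s < 0`, `p, q < ∞`).

Proof (compactness and translation): if `C(1; z_n)[w] ≥ η` with `|x_n| → ∞`, fix an apex time
`t'` slightly above `lim t_n` so that `Q_1(z_n) ⊆ Q_2(t', x_n)`, and zoom the translates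
`w(t' + 16·, x_n + 4·)` to suitable weak solutions `v_n` in `Q(1)` with
`∫_{Q(1/2)} |v_n|³ ≥ η/16` and uniform `L³ × L^{3/2}` bounds (`C, D ≤ K`). By the compactness of
suitable weak solutions (`SuitableCompactness_holds`, Albritton–Barker 2019, Prop. 2.2) a
subsequence converges strongly in `L³(Q(3/4))` to some `u_∞` with `∫_{Q(1/2)} |u_∞|³ ≥ η/16`. But
for a.e. `s` the slices `v_n(s)` are zoomed far translates of one realised Besov distribution, whose
pairings with test functions tend to zero (`tendsto_distribTranslate_apply_cocompact_of_memHomBesov`),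
while along a further subsequence `v_n(s) → u_∞(s)` in `L³(B_{3/4})`; hence `u_∞(s) = 0` a.e. on
`B_{3/4}` and `∫_{Q(1/2)} |u_∞|³ = 0`, a contradiction.

## References

* W. Wang, Z. Zhang, Sci. China Math. 60 (2017) 637–650 = arXiv:1510.02589, §4 Step 1.
  [WangZhang2016]
* D. Albritton, T. Barker, J. Math. Fluid Mech. 21 (2019), Prop. 2.2. [AlbrittonBarker2019]
* H. Bahouri, J.-Y. Chemin, R. Danchin, *Fourier Analysis and Nonlinear PDE* (2011), Prop. 2.18,
  Prop. 2.27. [BahouriCheminDanchin2011]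
-/

noncomputable section

open MeasureTheory Set Function Filter Topology TopologicalSpace Metric Bornology
open scoped NNReal ENNReal SchwartzMap

namespace Literature.Analysis.FluidPDE

open FunctionSpaces.EuclideanSpace (complexify)

/-! ### Restriction of Albritton–Barker's class to a sub-cylinder of `Q(a)` -/

section Restrict

variable {u : ℝ → EuclideanSpace ℝ (Fin 3) → EuclideanSpace ℝ (Fin 3)}
  {p : ℝ → EuclideanSpace ℝ (Fin 3) → ℝ}

/-- **Restriction of the class of A–B's Def. 2.1 to a sub-cylinder**: if `(u, p)` is a suitable
weak solution in `Q(a)` (about the origin) and `Q_r(z) ⊆ Q(a)`, `r > 0`, then `(u, p)` is a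
suitable weak solution in `Q_r(z)`. [folklore] -/
theorem IsSuitableWeakSolutionInBall.of_subset_zero {a r : ℝ}
    (h : IsSuitableWeakSolutionInBall a (0 : ℝ × EuclideanSpace ℝ (Fin 3)) u p) (hr : 0 < r)
    {z : ℝ × EuclideanSpace ℝ (Fin 3)}
    (hsub : parabolicCylinder r z ⊆ parabolicCylinder a (0 : ℝ × EuclideanSpace ℝ (Fin 3))) :
    IsSuitableWeakSolutionInBall r z u p := by
  obtain ⟨hsw, ⟨C, hC⟩, ⟨G, hG, hG2⟩, hp⟩ := h
  have hle : parabolicCylinderOpens r z ≤ parabolicCylinderOpens a (0 : ℝ × EuclideanSpace ℝ (Fin 3)) :=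
    fun w hw => hsub hw
  -- the factors of the product inclusion
  have hprod : Ioo (z.1 - r ^ 2) z.1 ⊆ Ioo (-a ^ 2) (0 : ℝ) ∧
      ball z.2 r ⊆ ball (0 : EuclideanSpace ℝ (Fin 3)) a := by
    have h1 : Ioo (z.1 - r ^ 2) z.1 ×ˢ ball z.2 r ⊆ Ioo (-a ^ 2) (0 : ℝ) ×ˢ
        ball (0 : EuclideanSpace ℝ (Fin 3)) a := by
      intro w hw
      have := hsub (show w ∈ parabolicCylinder r z from hw)
      rw [mem_parabolicCylinder] at this
      simpa using this
    rcases prod_subset_prod_iff.1 h1 with h2 | h2 | h2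
    · exact h2
    · exact absurd h2 (nonempty_Ioo.2 (by nlinarith)).ne_empty
    · exact absurd h2 (nonempty_ball.2 hr).ne_empty
  refine ⟨hsw.of_le hle, ⟨C, ?_⟩, ⟨G, hG.mono hle, lt_of_le_of_lt (lintegral_mono_set hsub) hG2⟩,
    hp.mono_measure (Measure.restrict_mono hsub le_rfl)⟩
  simp only [Prod.fst_zero, Prod.snd_zero, zero_sub] at hC
  have hC' := ae_restrict_of_ae_restrict_of_subset hprod.1 hC
  filter_upwards [hC'] with t ht
  exact (lintegral_mono_set hprod.2).trans ht

end Restrict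

/-! ### Measure-theoretic tools -/

section Tools

/-- **Lower bounds of `∫_S |·|³` pass to strong `L³` limits**: if `v_k → u` in `L³(Q₀)`,
`S ⊆ Q₀`, and `b ≤ ∫_S |v_k|³` for all `k`, then `b ≤ ∫_S |u|³` (Minkowski). [folklore] -/
theorem le_setLIntegral_cube_of_tendsto_eLpNorm {Q₀ S : Set (ℝ × EuclideanSpace ℝ (Fin 3))}
    (hS : S ⊆ Q₀) {v : ℕ → ℝ → EuclideanSpace ℝ (Fin 3) → EuclideanSpace ℝ (Fin 3)}
    {u : ℝ → EuclideanSpace ℝ (Fin 3) → EuclideanSpace ℝ (Fin 3)}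
    (hv : ∀ k, AEStronglyMeasurable (uncurry (v k)) (volume.restrict Q₀))
    (hu : AEStronglyMeasurable (uncurry u) (volume.restrict Q₀))
    (hconv : Tendsto (fun k => eLpNorm (uncurry (v k) - uncurry u) 3 (volume.restrict Q₀))
      atTop (𝓝 0))
    {b : ℝ≥0∞} (hlow : ∀ k, b ≤ ∫⁻ q in S, ‖v k q.1 q.2‖ₑ ^ (3 : ℕ)) :
    b ≤ ∫⁻ q in S, ‖u q.1 q.2‖ₑ ^ (3 : ℕ) := by
  set μ' : Measure (ℝ × EuclideanSpace ℝ (Fin 3)) := volume.restrict S with hμ'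
  have hμle : μ' ≤ volume.restrict Q₀ := Measure.restrict_mono hS le_rfl
  -- `b^{1/3} ≤ ‖v_k‖₃ ≤ ‖u‖₃ + ‖v_k - u‖₃`
  have hble : ∀ k, b ^ (1 / 3 : ℝ) ≤ eLpNorm (uncurry u) 3 μ' +
      eLpNorm (uncurry (v k) - uncurry u) 3 (volume.restrict Q₀) := by
    intro k
    have h1 : b ^ (1 / 3 : ℝ) ≤ eLpNorm (uncurry (v k)) 3 μ' := by
      rw [eLpNorm_three_eq_lintegral_cube_rpow]
      exact ENNReal.rpow_le_rpow (hlow k) (by norm_num)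
    have h2 : eLpNorm (uncurry (v k)) 3 μ' ≤ eLpNorm (uncurry u) 3 μ' +
        eLpNorm (uncurry (v k) - uncurry u) 3 μ' := by
      have e : uncurry (v k) = uncurry u + (uncurry (v k) - uncurry u) := by abel
      conv_lhs => rw [e]
      exact eLpNorm_add_le (hu.mono_measure hμle) ((hv k).sub hu |>.mono_measure hμle) (by norm_num)
    exact h1.trans (h2.trans (add_le_add le_rfl (eLpNorm_mono_measure _ hμle)))
  have hlim : Tendsto (fun k => eLpNorm (uncurry u) 3 μ' +
      eLpNorm (uncurry (v k) - uncurry u) 3 (volume.restrict Q₀)) atTop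
      (𝓝 (eLpNorm (uncurry u) 3 μ' + 0)) := tendsto_const_nhds.add hconv
  rw [add_zero] at hlim
  have h := ge_of_tendsto hlim (Eventually.of_forall hble)
  rw [eLpNorm_three_eq_lintegral_cube_rpow] at h
  have h' := ENNReal.rpow_le_rpow h (by norm_num : (0 : ℝ) ≤ 3)
  rwa [← ENNReal.rpow_mul, ← ENNReal.rpow_mul, show (1 / 3 : ℝ) * 3 = 1 by norm_num,
    ENNReal.rpow_one, ENNReal.rpow_one] at h'

/-- **A subsequence along which the slices converge, a.e. in time, on one cylinder**: if
`U_j → w` in `L³(Q_R(0))`, then along a strictly increasing `φ`, for a.e. `t ∈ ]-R², 0[`,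
`∫_{B(0,R)} |U_{φ(k)}(t) - w(t)|³ → 0` (summable subsequence of the `L³` distances, Tonelli).
[folklore] -/
theorem exists_strictMono_ae_tendsto_slices_cylinder {R : ℝ}
    {U : ℕ → ℝ → EuclideanSpace ℝ (Fin 3) → EuclideanSpace ℝ (Fin 3)}
    {w : ℝ → EuclideanSpace ℝ (Fin 3) → EuclideanSpace ℝ (Fin 3)}
    (hUm : ∀ j, AEStronglyMeasurable (uncurry (U j))
      (volume.restrict (parabolicCylinder R (0 : ℝ × EuclideanSpace ℝ (Fin 3)))))
    (hwm : AEStronglyMeasurable (uncurry w)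
      (volume.restrict (parabolicCylinder R (0 : ℝ × EuclideanSpace ℝ (Fin 3)))))
    (hconv : Tendsto (fun j => eLpNorm (uncurry (U j) - uncurry w) 3
      (volume.restrict (parabolicCylinder R (0 : ℝ × EuclideanSpace ℝ (Fin 3))))) atTop (𝓝 0)) :
    ∃ φ : ℕ → ℕ, StrictMono φ ∧
      ∀ᵐ t ∂(volume.restrict (Ioo (-R ^ 2) 0)),
        Tendsto (fun k => ∫⁻ x in ball (0 : EuclideanSpace ℝ (Fin 3)) R,
          ‖U (φ k) t x - w t x‖ₑ ^ (3 : ℕ)) atTop (𝓝 0) := by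
  classical
  set G : ℕ → ℝ → ℝ≥0∞ := fun j t =>
    ∫⁻ x in ball (0 : EuclideanSpace ℝ (Fin 3)) R, ‖U j t x - w t x‖ₑ ^ (3 : ℕ) with hG
  set F : ℕ → ℝ≥0∞ := fun j => ∫⁻ t in Ioo (-R ^ 2) 0, G j t with hF
  have hQ : parabolicCylinder R (0 : ℝ × EuclideanSpace ℝ (Fin 3)) =
      Ioo (-R ^ 2) 0 ×ˢ ball (0 : EuclideanSpace ℝ (Fin 3)) R := by
    rw [parabolicCylinder]; simp
  have hDm : ∀ j, AEMeasurable (fun q : ℝ × EuclideanSpace ℝ (Fin 3) => ‖U j q.1 q.2 - w q.1 q.2‖ₑ ^ (3 : ℕ))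
      ((volume.restrict (Ioo (-R ^ 2) 0)).prod
        (volume.restrict (ball (0 : EuclideanSpace ℝ (Fin 3)) R))) := by
    intro j
    rw [Measure.prod_restrict, ← Measure.volume_eq_prod, ← hQ]
    exact (((hUm j).sub hwm).aemeasurable.enorm.pow_const _)
  have hGm : ∀ j, AEMeasurable (G j) (volume.restrict (Ioo (-R ^ 2) 0)) :=
    fun j => (hDm j).lintegral_prod_right'
  have hFeq : ∀ j, F j = eLpNorm (uncurry (U j) - uncurry w) 3
      (volume.restrict (parabolicCylinder R (0 : ℝ × EuclideanSpace ℝ (Fin 3)))) ^ (3 : ℝ) := by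
    intro j
    rw [eLpNorm_eq_lintegral_rpow_enorm_toReal (by norm_num) (by norm_num), ENNReal.toReal_ofNat,
      ← ENNReal.rpow_mul, show (1 / (3 : ℝ)) * 3 = 1 by norm_num, ENNReal.rpow_one, hQ,
      Measure.volume_eq_prod, ← Measure.prod_restrict, lintegral_prod _ (by
        have h := hDm j
        have e : (fun q : ℝ × EuclideanSpace ℝ (Fin 3) => ‖(uncurry (U j) - uncurry w) q‖ₑ ^ (3 : ℝ)) =
            fun q => ‖U j q.1 q.2 - w q.1 q.2‖ₑ ^ (3 : ℕ) := by
          funext q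
          rw [← ENNReal.rpow_natCast]
          norm_num
          rfl
        rw [e]; exact h)]
    rw [hF, hG]
    dsimp only
    refine lintegral_congr fun t => lintegral_congr fun x => ?_
    rw [← ENNReal.rpow_natCast]
    norm_num
  have hF0 : Tendsto F atTop (𝓝 0) := by
    have h := ((ENNReal.continuous_rpow_const (y := (3 : ℝ))).tendsto 0).comp hconv
    rw [ENNReal.zero_rpow_of_pos (by norm_num)] at h
    refine h.congr fun j => ?_
    rw [Function.comp_apply, hFeq j]
  -- the subsequence with `F (φ k) ≤ 2^{-k}`
  set ε : ℕ → ℝ≥0∞ := fun k => (2⁻¹ : ℝ≥0∞) ^ k with hε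
  have hεpos : ∀ k, 0 < ε k := fun k => ENNReal.pow_pos (by simp) k
  have hstage : ∀ k m : ℕ, ∃ j : ℕ, m < j ∧ F j ≤ ε k := by
    intro k m
    obtain ⟨j, hj⟩ := ((((tendsto_order.1 hF0).2 (ε k) (hεpos k)).mono fun j hj => hj.le).and
      (eventually_gt_atTop m)).exists
    exact ⟨j, hj.2, hj.1⟩
  choose nxt hnxt_gt hnxt_le using hstage
  set φ : ℕ → ℕ := fun k => Nat.rec (nxt 0 0) (fun k j => nxt (k + 1) j) k with hφdef
  have hφ0 : φ 0 = nxt 0 0 := rfl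
  have hφsucc : ∀ k, φ (k + 1) = nxt (k + 1) (φ k) := fun k => rfl
  have hφmono : StrictMono φ := strictMono_nat_of_lt_succ fun k => by
    rw [hφsucc]; exact hnxt_gt _ _
  have hφle : ∀ k, F (φ k) ≤ ε k := by
    intro k
    induction k with
    | zero => rw [hφ0]; exact hnxt_le 0 0
    | succ k _ => rw [hφsucc]; exact hnxt_le (k + 1) (φ k)
  refine ⟨φ, hφmono, ?_⟩
  have hεsum : ∑' k, ε k < ⊤ := by
    rw [hε, ENNReal.tsum_geometric, ENNReal.one_sub_inv_two, inv_inv]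
    exact ENNReal.ofNat_lt_top
  have hint : ∫⁻ t in Ioo (-R ^ 2) 0, ∑' k, G (φ k) t < ⊤ := by
    rw [lintegral_tsum fun k => hGm (φ k)]
    exact ((ENNReal.tsum_le_tsum hφle).trans_lt hεsum)
  have hae : ∀ᵐ t ∂(volume.restrict (Ioo (-R ^ 2) 0)), ∑' k, G (φ k) t < ⊤ :=
    ae_lt_top' (AEMeasurable.tsum fun k => hGm (φ k)) hint.ne
  filter_upwards [hae] with t ht
  exact ENNReal.tendsto_atTop_zero_of_tsum_ne_top ht.ne

/-- **A slice in `L³(B)` pairs integrably with a test function supported in `B`**. [folklore] -/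
theorem integrable_smul_complexify_of_lintegral_ball_lt_top {f : EuclideanSpace ℝ (Fin 3) → EuclideanSpace ℝ (Fin 3)}
    {R : ℝ} (hfm : AEStronglyMeasurable f (volume.restrict (ball (0 : EuclideanSpace ℝ (Fin 3)) R)))
    (hf : ∫⁻ x in ball (0 : EuclideanSpace ℝ (Fin 3)) R, ‖f x‖ₑ ^ (3 : ℕ) < ⊤)
    (θ : 𝓢(EuclideanSpace ℝ (Fin 3), ℂ))
    (hθ : tsupport (θ : EuclideanSpace ℝ (Fin 3) → ℂ) ⊆ ball (0 : EuclideanSpace ℝ (Fin 3)) R) :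
    Integrable (fun x => θ x • complexify (f x)) := by
  set B : Set (EuclideanSpace ℝ (Fin 3)) := ball 0 R with hB
  -- the integrand vanishes off `B`
  have hzero : ∀ x, x ∉ B → θ x • complexify (f x) = 0 := fun x hx => by
    have : θ x = 0 := image_eq_zero_of_notMem_tsupport fun h => hx (hθ h)
    rw [this, zero_smul]
  have hind : (fun x => θ x • complexify (f x)) = B.indicator fun x => θ x • complexify (f x) := by
    funext x
    by_cases hx : x ∈ B
    · rw [indicator_of_mem hx]
    · rw [indicator_of_notMem hx, hzero x hx]
  rw [hind, integrable_indicator_iff measurableSet_ball]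
  -- on `B`: `θ` bounded, `f ∈ L³(B) ⊆ L¹(B)`
  have hf3 : MemLp f 3 (volume.restrict B) := by
    refine ⟨hfm, ?_⟩
    rw [eLpNorm_three_eq_lintegral_cube_rpow]
    exact ENNReal.rpow_lt_top_of_nonneg (by norm_num) hf.ne
  haveI : IsFiniteMeasure (volume.restrict B) := isFiniteMeasure_restrict.2 measure_ball_lt_top.ne
  have hf1 : Integrable f (volume.restrict B) := hf3.integrable (by norm_num)
  have hcf : Integrable (fun x => complexify (f x)) (volume.restrict B) :=
    (complexify (ι := Fin 3)).toContinuousLinearMap.integrable_comp hf1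
  obtain ⟨C₀, hC₀⟩ : ∃ C₀ : ℝ, ∀ x, ‖θ x‖ ≤ C₀ := by
    obtain ⟨C, -, hC⟩ := θ.decay 0 0
    exact ⟨C, fun x => by simpa using hC x⟩
  exact hcf.bdd_smul C₀ θ.continuous.aestronglyMeasurable.restrict (ae_of_all _ fun x => hC₀ x)

end Tools

/-! ### Vanishing of a slice from vanishing compactly supported Schwartz pairings -/

section SliceZero

/-- **A locally integrable field on a ball all of whose pairings with Schwartz functions supported
in the ball vanish is zero a.e. on the ball.** [folklore] -/
theorem ae_eq_zero_on_ball_of_forall_schwartz_integral_eq_zero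
    {f : EuclideanSpace ℝ (Fin 3) → EuclideanSpace ℝ (Fin 3)} {R : ℝ}
    (hf : IntegrableOn f (ball (0 : EuclideanSpace ℝ (Fin 3)) R))
    (h : ∀ θ : 𝓢(EuclideanSpace ℝ (Fin 3), ℂ),
      tsupport (θ : EuclideanSpace ℝ (Fin 3) → ℂ) ⊆ ball (0 : EuclideanSpace ℝ (Fin 3)) R →
        ∫ x, θ x • complexify (f x) = 0) :
    ∀ᵐ x ∂volume, x ∈ ball (0 : EuclideanSpace ℝ (Fin 3)) R → f x = 0 := by
  refine (isOpen_ball).ae_eq_zero_of_integral_contDiff_smul_eq_zero hf.locallyIntegrableOn ?_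
  intro g hg hgc hgU
  -- the complex Schwartz function `x ↦ (g x : ℂ)`
  have hgc' : HasCompactSupport fun x => (g x : ℂ) := hgc.comp_left Complex.ofReal_zero
  have hgs : ContDiff ℝ (⊤ : ℕ∞) fun x => (g x : ℂ) := Complex.ofRealCLM.contDiff.comp hg
  set θ : 𝓢(EuclideanSpace ℝ (Fin 3), ℂ) := hgc'.toSchwartzMap hgs with hθ
  have hθx : ∀ x, θ x = (g x : ℂ) := fun x => rfl
  have hsupp : tsupport (θ : EuclideanSpace ℝ (Fin 3) → ℂ) ⊆ ball (0 : EuclideanSpace ℝ (Fin 3)) R := by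
    refine (closure_mono ?_).trans hgU
    intro x hx
    rw [mem_support] at hx ⊢
    intro h0
    exact hx (by rw [show (θ : EuclideanSpace ℝ (Fin 3) → ℂ) x = (g x : ℂ) from rfl, h0, Complex.ofReal_zero])
  have h1 := h θ hsupp
  -- `∫ (g : ℂ) • complexify f = complexify (∫ g • f)`
  have e : (fun x => θ x • complexify (f x)) = fun x =>
      (complexify (ι := Fin 3)).toContinuousLinearMap (g x • f x) := by
    funext x
    rw [hθx, LinearIsometry.coe_toContinuousLinearMap, map_smul, Complex.coe_smul]
  -- integrability of `g • f`
  have hgf : Integrable fun x => g x • f x := by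
    obtain ⟨C₀, hC₀⟩ : ∃ C₀ : ℝ, ∀ x, ‖g x‖ ≤ C₀ := by
      obtain ⟨C, hC⟩ := (hg.continuous.norm).bddAbove_range_of_hasCompactSupport hgc.norm
      exact ⟨C, fun x => hC ⟨x, rfl⟩⟩
    have hB : IntegrableOn (fun x => g x • f x) (ball (0 : EuclideanSpace ℝ (Fin 3)) R) :=
      hf.bdd_smul C₀ hg.continuous.aestronglyMeasurable.restrict (ae_of_all _ fun x => hC₀ x)
    have hind : (fun x => g x • f x) = (ball (0 : EuclideanSpace ℝ (Fin 3)) R).indicator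
        fun x => g x • f x := by
      funext x
      by_cases hx : x ∈ ball (0 : EuclideanSpace ℝ (Fin 3)) R
      · rw [indicator_of_mem hx]
      · rw [indicator_of_notMem hx]
        have : g x = 0 := image_eq_zero_of_notMem_tsupport fun h' => hx (hgU h')
        rw [this, zero_smul]
    rw [hind, integrable_indicator_iff measurableSet_ball]
    exact hB
  rw [e, ContinuousLinearMap.integral_comp_comm _ hgf] at h1
  exact complexify_injective' h1
  where
  /-- injectivity against `0` -/
  complexify_injective' {v : EuclideanSpace ℝ (Fin 3)}
      (hv : (complexify (ι := Fin 3)).toContinuousLinearMap v = 0) : v = 0 := by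
    have : complexify (ι := Fin 3) v = complexify 0 := by
      rw [map_zero]; exact hv
    exact FunctionSpaces.EuclideanSpace.complexify_injective this

end SliceZero

/-! ### The far-field smallness -/

section Main

variable {w : ℝ → EuclideanSpace ℝ (Fin 3) → EuclideanSpace ℝ (Fin 3)}
  {π : ℝ → EuclideanSpace ℝ (Fin 3) → ℝ}

set_option maxHeartbeats 3200000 in
/-- **Far-field smallness of `C(1; z₀)` for an ancient solution with Besov slices** (Wang–Zhang
2017, §4 Step 1, the spatial decay of the blow-up limit, in the integral form consumed by
`exists_farField_ae_norm_le_of_cknC_farField_small`): let `(w, π)` be a suitable weak solution in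
every `Q(a)`, with `C, D ≤ K` at all apices `t ≤ 0` and all radii, whose slices `w(t)` are, for
a.e. `t ∈ ]-(T+16), 0[`, represented by realised `Ḃ^s_{p,q}` distributions (`-2 < s < 0`,
`p, q < ∞`). Then for every `η > 0` there is `R` with `C(1; (t₀, x₀))[w] ≤ η` whenever
`-T < t₀ < 0` and `|x₀| > R`. Proof in the module docstring. [cite: WangZhang2016, §4 Step 1] -/
theorem farField_cknC_small_of_ae_slice_memHomBesov
    (hw : ∀ a : ℝ, 0 < a → IsSuitableWeakSolutionInBall a (0 : ℝ × EuclideanSpace ℝ (Fin 3)) w π)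
    {K : ℝ≥0} (hK : ∀ z : ℝ × EuclideanSpace ℝ (Fin 3), z.1 ≤ 0 → ∀ r : ℝ, 0 < r →
      cknC r z w ≤ K ∧ cknD r z π ≤ K)
    {s : ℝ} (hs : -2 < s) (hs0 : s < 0) {p q : ℝ≥0∞} [Fact (1 ≤ p)] (hp : p ≠ ⊤)
    (hq₀ : q ≠ 0) (hq : q ≠ ⊤) {T : ℝ} (hT : 0 < T)
    (hslice : ∀ᵐ t ∂(volume.restrict (Ioo (-(T + 16)) 0)),
      ∃ W : 𝓢'(EuclideanSpace ℝ (Fin 3), EuclideanSpace ℂ (Fin 3)),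
        IsDistributionOf (w t) W ∧ FunctionSpaces.MemHomBesov s p q W) :
    ∀ η : ℝ, 0 < η → ∃ R : ℝ, ∀ z₀ : ℝ × EuclideanSpace ℝ (Fin 3),
      -T < z₀.1 → z₀.1 < 0 → R < ‖z₀.2‖ → cknC 1 z₀ w ≤ ENNReal.ofReal η := by
  intro η hη
  by_contra H
  push Not at H
  choose z hz1 hz2 hz3 hz4 using fun n : ℕ => H n
  -- ### Step 1: the apex times converge along a subsequence; a common apex time `t'`
  obtain ⟨tstar, htstar, φ₁, hφ₁, hlim⟩ := tendsto_subseq_of_bounded (Metric.isBounded_Icc (-T) 0)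
    (x := fun n => (z n).1) (fun n => ⟨(hz1 n).le, (hz2 n).le⟩)
  rw [closure_Icc] at htstar
  set t' : ℝ := min 0 (tstar + 1) with ht'def
  have ht'0 : t' ≤ 0 := min_le_left _ _
  have ht'T : -T < t' := by
    rw [ht'def, lt_min_iff]; exact ⟨by linarith, by linarith [htstar.1]⟩
  have hev : ∀ᶠ n in atTop, (z (φ₁ n)).1 ≤ t' ∧ t' - 3 ≤ (z (φ₁ n)).1 := by
    have h1 : ∀ᶠ n in atTop, dist ((z (φ₁ n)).1) tstar < 1 :=
      (Metric.tendsto_nhds.1 hlim) 1 one_pos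
    filter_upwards [h1] with n hn
    rw [Real.dist_eq, abs_lt] at hn
    refine ⟨le_min (hz2 _).le (by linarith), ?_⟩
    have : t' ≤ tstar + 1 := min_le_right _ _
    linarith
  obtain ⟨N₁, hN₁⟩ := hev.exists_forall_of_atTop
  -- the far centres
  set x : ℕ → EuclideanSpace ℝ (Fin 3) := fun n => (z (φ₁ (n + N₁))).2 with hxdef
  have hxge : ∀ n : ℕ, (n : ℝ) ≤ ‖x n‖ := fun n => by
    have h1 := hz3 (φ₁ (n + N₁))
    have h2 : (n : ℝ) ≤ (φ₁ (n + N₁) : ℕ) := by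
      exact_mod_cast le_trans (Nat.le_add_right n N₁) (hφ₁.id_le _)
    exact h2.trans h1.le
  have hxcc : Tendsto (fun n => -x n) atTop (cocompact (EuclideanSpace ℝ (Fin 3))) := by
    rw [← Metric.cobounded_eq_cocompact, ← tendsto_norm_atTop_iff_cobounded]
    simp_rw [norm_neg]
    exact tendsto_atTop_mono hxge tendsto_natCast_atTop_atTop
  set a : ℕ → ℝ × EuclideanSpace ℝ (Fin 3) := fun n => (t', x n) with hadef
  -- ### Step 2: concentration at the common apex time, radius 2
  have hconc : ∀ n, ENNReal.ofReal (η / 4) ≤ cknC 2 (a n) w := by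
    intro n
    obtain ⟨h1, h2⟩ := hN₁ (n + N₁) (Nat.le_add_left _ _)
    have hsub : parabolicCylinder 1 (z (φ₁ (n + N₁))) ⊆ parabolicCylinder 2 (a n) := by
      intro w' hw'
      rw [mem_parabolicCylinder] at hw' ⊢
      refine ⟨⟨by linarith [hw'.1.1], by linarith [hw'.1.2]⟩, ?_⟩
      exact (ball_subset_ball (by norm_num : (1 : ℝ) ≤ 2)) hw'.2
    have h3 := hz4 (φ₁ (n + N₁))
    rw [cknC, ENNReal.ofReal_one, one_pow, inv_one, one_mul] at h3
    rw [cknC, show (ENNReal.ofReal 2 ^ 2) = ENNReal.ofReal 4 by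
      rw [← ENNReal.ofReal_pow (by norm_num)]; norm_num]
    calc ENNReal.ofReal (η / 4) = (ENNReal.ofReal 4)⁻¹ * ENNReal.ofReal η := by
          rw [div_eq_mul_inv, ENNReal.ofReal_mul hη.le, ← ENNReal.ofReal_inv_of_pos (by norm_num),
            mul_comm]
      _ ≤ (ENNReal.ofReal 4)⁻¹ * ∫⁻ q in parabolicCylinder 1 (z (φ₁ (n + N₁))), ‖w q.1 q.2‖ₑ ^ (3 : ℕ) :=
          mul_le_mul' le_rfl h3.le
      _ ≤ (ENNReal.ofReal 4)⁻¹ * ∫⁻ q in parabolicCylinder 2 (a n), ‖w q.1 q.2‖ₑ ^ (3 : ℕ) :=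
          mul_le_mul' le_rfl (lintegral_mono_set hsub)
  -- ### Step 3: the zoomed translates are suitable weak solutions in `Q(1)` with uniform bounds
  set v : ℕ → ℝ → EuclideanSpace ℝ (Fin 3) → EuclideanSpace ℝ (Fin 3) :=
    fun n => (4 : ℝ) • stPull ((4 : ℝ) ^ 2) 4 (a n).1 (a n).2 w with hvdef
  set pq : ℕ → ℝ → EuclideanSpace ℝ (Fin 3) → ℝ :=
    fun n => (4 : ℝ) ^ 2 • stPull ((4 : ℝ) ^ 2) 4 (a n).1 (a n).2 π with hpqdef
  have hInBall4 : ∀ n, IsSuitableWeakSolutionInBall 4 (a n) w π := by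
    intro n
    set A : ℝ := ‖x n‖ + T + 17 with hA
    have hApos : 0 < A := by rw [hA]; positivity
    refine (hw A hApos).of_subset_zero (by norm_num) ?_
    intro w' hw'
    rw [mem_parabolicCylinder] at hw' ⊢
    simp only [hadef] at hw'
    have hA1 : T + 17 ≤ A := by rw [hA]; linarith [norm_nonneg (x n)]
    have hA2 : A ≤ A ^ 2 := by nlinarith
    refine ⟨⟨?_, ?_⟩, ?_⟩
    · simp only [Prod.fst_zero]; linarith [hw'.1.1]
    · simp only [Prod.fst_zero]; linarith [hw'.1.2]
    · simp only [Prod.snd_zero, dist_zero_right]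
      have h1 : dist w'.2 (x n) < 4 := hw'.2
      calc ‖w'.2‖ ≤ dist w'.2 (x n) + ‖x n‖ := by
            rw [dist_eq_norm]; exact norm_le_norm_sub_add _ _
        _ < A := by rw [hA]; linarith
  have hInBall1 : ∀ n, IsSuitableWeakSolutionInBall 1 0 (v n) (pq n) := fun n =>
    (hInBall4 n).zoom (by norm_num)
  -- the uniform bounds
  have hCa : ∀ n, cknC 4 (a n) w ≤ K := fun n => (hK (a n) ht'0 4 (by norm_num)).1
  have hDa : ∀ n, cknD 4 (a n) π ≤ K := fun n => (hK (a n) ht'0 4 (by norm_num)).2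
  have hbound : (⨆ n, eLpNorm (uncurry (v n)) 3
        (volume.restrict (parabolicCylinder 1 (0 : ℝ × EuclideanSpace ℝ (Fin 3)))) +
      eLpNorm (uncurry (pq n)) (3 / 2)
        (volume.restrict (parabolicCylinder 1 (0 : ℝ × EuclideanSpace ℝ (Fin 3))))) < ∞ := by
    have h1 : ∀ n, eLpNorm (uncurry (v n)) 3
        (volume.restrict (parabolicCylinder 1 (0 : ℝ × EuclideanSpace ℝ (Fin 3)))) ≤ (K : ℝ≥0∞) ^ (1 / 3 : ℝ) := by
      intro n
      rw [eLpNorm_three_eq_lintegral_cube_rpow]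
      refine ENNReal.rpow_le_rpow ?_ (by norm_num)
      have e := lintegral_cube_zoom (by norm_num : (0 : ℝ) < 4) (a n) w
      exact (le_of_eq e).trans (hCa n)
    have h2 : ∀ n, eLpNorm (uncurry (pq n)) (3 / 2)
        (volume.restrict (parabolicCylinder 1 (0 : ℝ × EuclideanSpace ℝ (Fin 3)))) ≤ (K : ℝ≥0∞) ^ (2 / 3 : ℝ) := by
      intro n
      obtain ⟨h32, h32', h32r⟩ := threeHalves_facts
      rw [eLpNorm_eq_lintegral_rpow_enorm_toReal (zero_lt_one.trans_le h32).ne' h32', h32r,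
        show (1 / (3 / 2 : ℝ)) = 2 / 3 by norm_num]
      refine ENNReal.rpow_le_rpow ?_ (by norm_num)
      have e := lintegral_pressure_zoom (by norm_num : (0 : ℝ) < 4) (a n) π
      exact (le_of_eq e).trans (hDa n)
    refine lt_of_le_of_lt (iSup_le fun n => add_le_add (h1 n) (h2 n)) ?_
    exact ENNReal.add_lt_top.2 ⟨ENNReal.rpow_lt_top_of_nonneg (by norm_num) ENNReal.coe_ne_top,
      ENNReal.rpow_lt_top_of_nonneg (by norm_num) ENNReal.coe_ne_top⟩
  -- ### Step 4: compactness
  obtain ⟨uinf, pinf, σ, hσ, hR⟩ := SuitableCompactness_holds v pq hInBall1 hbound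
  obtain ⟨-, hmem, hconvR, -⟩ := hR (3 / 4) ⟨by norm_num, by norm_num⟩
  set Q₀ : Set (ℝ × EuclideanSpace ℝ (Fin 3)) := parabolicCylinder (3 / 4) 0 with hQ₀
  set Qh : Set (ℝ × EuclideanSpace ℝ (Fin 3)) := parabolicCylinder (1 / 2) 0 with hQh
  have hQhQ₀ : Qh ⊆ Q₀ := parabolicCylinder_mono (by norm_num) (by norm_num) _
  have hQ₀1 : Q₀ ⊆ parabolicCylinder 1 (0 : ℝ × EuclideanSpace ℝ (Fin 3)) :=
    parabolicCylinder_mono (by norm_num) (by norm_num) _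
  have hvm : ∀ n, AEStronglyMeasurable (uncurry (v n)) (volume.restrict Q₀) := fun n =>
    ((hInBall1 n).1.distributional.1.aestronglyMeasurable).mono_measure
      (Measure.restrict_mono hQ₀1 le_rfl)
  have hum : AEStronglyMeasurable (uncurry uinf) (volume.restrict Q₀) := hmem.aestronglyMeasurable
  -- ### Step 5: the lower bound passes to the limit
  set b : ℝ≥0∞ := ENNReal.ofReal (1 / 2) ^ 2 * ENNReal.ofReal (η / 4) with hbdef
  have hbpos : 0 < b := ENNReal.mul_pos (pow_ne_zero _ (ENNReal.ofReal_pos.2 (by norm_num)).ne')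
    (ENNReal.ofReal_pos.2 (by positivity)).ne'
  have hlow : ∀ n, b ≤ ∫⁻ q' in Qh, ‖v n q'.1 q'.2‖ₑ ^ (3 : ℕ) := by
    intro n
    have h1 : cknC (1 / 2) 0 (v n) = cknC 2 (a n) w := by
      have e0 : stAffine ((4 : ℝ) ^ 2) 4 (a n).1 (a n).2 (0 : ℝ × EuclideanSpace ℝ (Fin 3)) = a n := by
        rw [show (0 : ℝ × EuclideanSpace ℝ (Fin 3)) = ((0 : ℝ), (0 : EuclideanSpace ℝ (Fin 3))) from rfl,
          stAffine_apply, mul_zero, add_zero, smul_zero, add_zero]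
      rw [hvdef]
      dsimp only
      rw [cknC_nsZoom (by norm_num : (0 : ℝ) < 4) (by norm_num : (0 : ℝ) < 1 / 2) (a n).1 (a n).2 0 w,
        e0, show (4 : ℝ) * (1 / 2) = 2 by norm_num]
    have h2 : ENNReal.ofReal (η / 4) ≤ cknC (1 / 2) 0 (v n) := h1 ▸ hconc n
    rw [cknC] at h2
    have h0 : ENNReal.ofReal (1 / 2 : ℝ) ^ 2 ≠ 0 := pow_ne_zero _ (ENNReal.ofReal_pos.2 (by norm_num)).ne'
    have htop : ENNReal.ofReal (1 / 2 : ℝ) ^ 2 ≠ ⊤ := ENNReal.pow_ne_top ENNReal.ofReal_ne_top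
    have := mul_le_mul' (le_refl (ENNReal.ofReal (1 / 2 : ℝ) ^ 2)) h2
    rwa [← mul_assoc, ENNReal.mul_inv_cancel h0 htop, one_mul] at this
  have hlowlim : b ≤ ∫⁻ q' in Qh, ‖uinf q'.1 q'.2‖ₑ ^ (3 : ℕ) :=
    le_setLIntegral_cube_of_tendsto_eLpNorm hQhQ₀ (fun k => hvm (σ k)) hum hconvR fun k => hlow (σ k)
  -- ### Step 6: the slices of the limit vanish
  -- (a) a further subsequence with a.e. converging slices on `B(0, 3/4)`
  obtain ⟨ψ, hψ, hψae⟩ := exists_strictMono_ae_tendsto_slices_cylinder (R := 3 / 4)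
    (fun k => hvm (σ k)) hum hconvR
  -- (b) the slices of `w` at the times `t' + 16 s'`, a.e. in `s'`
  have hslice' : ∀ᵐ s' ∂(volume.restrict (Ioo (-(3 / 4 : ℝ) ^ 2) 0)),
      ∃ W : 𝓢'(EuclideanSpace ℝ (Fin 3), EuclideanSpace ℂ (Fin 3)),
        IsDistributionOf (w (t' + 16 * s')) W ∧ FunctionSpaces.MemHomBesov s p q W := by
    refine ae_restrict_comp_affine' measurableSet_Ioo hslice (by norm_num : (16 : ℝ) ≠ 0)
      measurableSet_Ioo fun s' hs' => ?_
    refine ⟨by nlinarith [hs'.1, ht'T], ?_⟩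
    nlinarith [hs'.2, ht'0]
  -- (c) the slices of `uinf` are in `L³(B(0, 3/4))` and measurable there, a.e.
  have hQ₀eq : Q₀ = Ioo (-(3 / 4 : ℝ) ^ 2) 0 ×ˢ ball (0 : EuclideanSpace ℝ (Fin 3)) (3 / 4) := by
    rw [hQ₀, parabolicCylinder]; simp
  have hprodm : AEStronglyMeasurable (uncurry uinf)
      ((volume.restrict (Ioo (-(3 / 4 : ℝ) ^ 2) 0)).prod
        (volume.restrict (ball (0 : EuclideanSpace ℝ (Fin 3)) (3 / 4)))) := by
    rw [Measure.prod_restrict, ← Measure.volume_eq_prod, ← hQ₀eq]; exact hum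
  have hslm : ∀ᵐ s' ∂(volume.restrict (Ioo (-(3 / 4 : ℝ) ^ 2) 0)),
      AEStronglyMeasurable (uinf s') (volume.restrict (ball (0 : EuclideanSpace ℝ (Fin 3)) (3 / 4))) :=
    hprodm.prodMk_left
  have hsl3 : ∀ᵐ s' ∂(volume.restrict (Ioo (-(3 / 4 : ℝ) ^ 2) 0)),
      ∫⁻ y in ball (0 : EuclideanSpace ℝ (Fin 3)) (3 / 4), ‖uinf s' y‖ₑ ^ (3 : ℕ) < ⊤ := by
    have hfin : ∫⁻ q' in Q₀, ‖uinf q'.1 q'.2‖ₑ ^ (3 : ℕ) < ⊤ := by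
      have h1 := hmem.eLpNorm_lt_top
      rw [eLpNorm_three_eq_lintegral_cube_rpow] at h1
      have h2 := ENNReal.rpow_lt_top_iff_of_pos (by norm_num : (0 : ℝ) < 1 / 3) |>.1 h1
      exact h2
    have hm3 : AEMeasurable (fun q' : ℝ × EuclideanSpace ℝ (Fin 3) => ‖uinf q'.1 q'.2‖ₑ ^ (3 : ℕ))
        ((volume.restrict (Ioo (-(3 / 4 : ℝ) ^ 2) 0)).prod
          (volume.restrict (ball (0 : EuclideanSpace ℝ (Fin 3)) (3 / 4)))) :=
      hprodm.aemeasurable.enorm.pow_const _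
    rw [hQ₀eq, Measure.volume_eq_prod, ← Measure.prod_restrict, lintegral_prod _ hm3] at hfin
    exact ae_lt_top' hm3.lintegral_prod_right' hfin.ne
  -- (d)+(e) at a.e. `s'`: all pairings with test functions supported in the ball vanish
  have hzero : ∀ᵐ s' ∂(volume.restrict (Ioo (-(3 / 4 : ℝ) ^ 2) 0)),
      ∀ᵐ y ∂volume, y ∈ ball (0 : EuclideanSpace ℝ (Fin 3)) (3 / 4) → uinf s' y = 0 := by
    filter_upwards [hψae, hslice', hslm, hsl3] with s' h1 h2 h3 h4
    obtain ⟨W, hW, hWB⟩ := h2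
    haveI : IsFiniteMeasure (volume.restrict (ball (0 : EuclideanSpace ℝ (Fin 3)) (3 / 4))) :=
      isFiniteMeasure_restrict.2 measure_ball_lt_top.ne
    have hint : IntegrableOn (uinf s') (ball (0 : EuclideanSpace ℝ (Fin 3)) (3 / 4)) := by
      have hf3 : MemLp (uinf s') 3 (volume.restrict (ball (0 : EuclideanSpace ℝ (Fin 3)) (3 / 4))) := by
        refine ⟨h3, ?_⟩
        rw [eLpNorm_three_eq_lintegral_cube_rpow]
        exact ENNReal.rpow_lt_top_of_nonneg (by norm_num) h4.ne
      exact hf3.integrable (by norm_num)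
    refine ae_eq_zero_on_ball_of_forall_schwartz_integral_eq_zero hint fun θ hθ => ?_
    -- the pairings of the approximating slices
    set c4 : ℝˣ := Units.mk0 (4 : ℝ) (by norm_num) with hc4
    have hrep : ∀ m, IsDistributionOf (v m s')
        (rescaleDistrib c4 (FunctionSpaces.distribTranslate (EuclideanSpace ℂ (Fin 3)) (-x m) W)) := by
      intro m
      have h := hW.rescaleData_translate_add (x m) c4
      have e : v m s' = fun y => (c4 : ℝ) • w (t' + 16 * s') (x m + (c4 : ℝ) • y) := by
        funext y
        rw [hvdef]
        simp only [Pi.smul_apply, stPull_apply, hadef, hc4, Units.val_mk0]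
        norm_num
      rw [e]; exact h
    -- they tend to zero
    set θ₄ : 𝓢(EuclideanSpace ℝ (Fin 3), ℂ) := SchwartzMap.compCLMOfContinuousLinearEquiv ℂ
      (ContinuousLinearEquiv.smulLeft (c4⁻¹ : ℝˣ) : EuclideanSpace ℝ (Fin 3) ≃L[ℝ] EuclideanSpace ℝ (Fin 3)) θ
      with hθ₄
    have hpair : ∀ m, ∫ y, θ y • complexify (v m s' y) =
        ((c4 : ℝ) : ℂ) • (((|(c4 : ℝ)|⁻¹ ^ Module.finrank ℝ (EuclideanSpace ℝ (Fin 3)) : ℝ) : ℂ) •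
          FunctionSpaces.distribTranslate (EuclideanSpace ℂ (Fin 3)) (-x m) W θ₄) := by
      intro m
      rw [← ((hrep m) θ).2, rescaleDistrib_apply, FunLike.coe_smul, Pi.smul_apply,
        FunctionSpaces.distribDilate_apply_apply]
    have hto0 : Tendsto (fun m => ∫ y, θ y • complexify (v m s' y)) atTop (𝓝 0) := by
      simp_rw [hpair]
      have h0 := (FunctionSpaces.tendsto_distribTranslate_apply_cocompact_of_memHomBesov hs hs0 hp hq₀ hq
        hWB θ₄).comp hxcc
      have h1 := (h0.const_smul (((|(c4 : ℝ)|⁻¹ ^ Module.finrank ℝ (EuclideanSpace ℝ (Fin 3)) : ℝ) : ℂ))).const_smul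
        ((c4 : ℝ) : ℂ)
      simpa only [smul_zero, Function.comp_def] using h1
    -- along `σ ∘ ψ` they converge to the pairing of `uinf s'`
    have hlimθ : Tendsto (fun k => ∫ y, θ y • complexify (v (σ (ψ k)) s' y)) atTop
        (𝓝 (∫ y, θ y • complexify (uinf s' y))) :=
      tendsto_integral_smul_complexify_of_tendsto_lintegral_ball θ hθ
        (fun k => ((hrep _) θ).1)
        (integrable_smul_complexify_of_lintegral_ball_lt_top h3 h4 θ hθ)
        (fun k => (IsDistributionOf.aestronglyMeasurable (hrep _)).restrict) h3 h1
    have hto0' : Tendsto (fun k => ∫ y, θ y • complexify (v (σ (ψ k)) s' y)) atTop (𝓝 0) :=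
      hto0.comp ((hσ.comp hψ).tendsto_atTop)
    exact tendsto_nhds_unique hlimθ hto0'
  -- ### Step 7: `∫_{Q(1/2)} |uinf|³ = 0`, contradiction
  have hQheq : Qh = Ioo (-(1 / 2 : ℝ) ^ 2) 0 ×ˢ ball (0 : EuclideanSpace ℝ (Fin 3)) (1 / 2) := by
    rw [hQh, parabolicCylinder]; simp
  have hIsub : Ioo (-(1 / 2 : ℝ) ^ 2) (0 : ℝ) ⊆ Ioo (-(3 / 4 : ℝ) ^ 2) 0 :=
    Ioo_subset_Ioo (by norm_num) le_rfl
  have hprodm' : AEStronglyMeasurable (uncurry uinf)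
      ((volume.restrict (Ioo (-(1 / 2 : ℝ) ^ 2) 0)).prod
        (volume.restrict (ball (0 : EuclideanSpace ℝ (Fin 3)) (1 / 2)))) := by
    rw [Measure.prod_restrict, ← Measure.volume_eq_prod, ← hQheq]
    exact hum.mono_measure (Measure.restrict_mono hQhQ₀ le_rfl)
  have hint0 : ∫⁻ q' in Qh, ‖uinf q'.1 q'.2‖ₑ ^ (3 : ℕ) = 0 := by
    have hm3' : AEMeasurable (fun q' : ℝ × EuclideanSpace ℝ (Fin 3) => ‖uinf q'.1 q'.2‖ₑ ^ (3 : ℕ))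
        ((volume.restrict (Ioo (-(1 / 2 : ℝ) ^ 2) 0)).prod
          (volume.restrict (ball (0 : EuclideanSpace ℝ (Fin 3)) (1 / 2)))) :=
      hprodm'.aemeasurable.enorm.pow_const _
    rw [hQheq, Measure.volume_eq_prod, ← Measure.prod_restrict, lintegral_prod _ hm3']
    refine (lintegral_eq_zero_iff' hm3'.lintegral_prod_right').2 ?_
    filter_upwards [ae_restrict_of_ae_restrict_of_subset hIsub hzero] with s' hs'
    simp only [Pi.zero_apply]
    have hae : (fun y => ‖uinf s' y‖ₑ ^ (3 : ℕ)) =ᵐ[volume.restrict (ball (0 : EuclideanSpace ℝ (Fin 3)) (1 / 2))]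
        (0 : EuclideanSpace ℝ (Fin 3) → ℝ≥0∞) := by
      rw [EventuallyEq, ae_restrict_iff' measurableSet_ball]
      filter_upwards [hs'] with y hy hyb
      rw [hy (ball_subset_ball (by norm_num : (1 / 2 : ℝ) ≤ 3 / 4) hyb)]
      simp
    show ∫⁻ y in ball (0 : EuclideanSpace ℝ (Fin 3)) (1 / 2), ‖uncurry uinf (s', y)‖ₑ ^ (3 : ℕ) = 0
    simp only [uncurry_apply_pair]
    rw [lintegral_congr_ae hae]
    simp
  exact absurd (hlowlim.trans (le_of_eq hint0)) (not_le.2 hbpos)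

end Main

end Literature.Analysis.FluidPDE

end
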